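/-
Copyright: the b2b-balaban T⁴-continuum CRUX team, row NE7b OWNER lineage `t4-ne7b-p1` (gen 125). Project licence.
-/
import Summits.QuantumFields.BalabanUV.T4Continuum.Spine.NE7b.SupZdPerturbedCovarianceLipschitz
import Summits.QuantumFields.BalabanUV.T4Continuum.Spine.NE7b.SupZdPerturbedCoarseForm

/-!
# THE ONE-STOP HEADLINE OF THE `H + K` COLUMN ON `ℤ^d`: (225)'s objects `Ψ, Ψ^K, M, N_K` with ALL their clauses (A)–(E) (block columns,
# coarse inverse, perturbed coarse inverse with uniqueness, response and covariance Lipschitz in `K`) AND, for the SAME objects, (F)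
# symmetry of `T_K`, `N_K` whenever `K` is symmetric ((232)'s argument) and (G) the `ℓ²` column — `|T_K| ≤ 2C_PK_{δ₀−μ}e^{−μ}` always, and
# under `D_EK_μ ≤ γ_Q∕2` the floor `γ_Q∕2`, the form bound `Λ_T + γ_Q∕2` and `N_K`'s four form bounds ((234)'s argument via (233)) — as INNER
# implications, so that no hypothesis is added at the top and no constant needs matching across the fork (222)→(223)→(225) ∕
# (222)→(232)→(234): ONE `obtain` gives everything about one quadruple of objects (row NE7b, node U5c; (186)∕(191)∕(225)∕(231)∕(233)∕(234) BY
# NAME; [folklore])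

Cell `pub-balaban`, sub-cell `t4`, spine estimate NE7b (`T4WeightBudget.RelWeightBound`; the cell's OWN estimate — NOT PRINTED in
[Bałaban 1983–89], NOT PROVED).  Crux-route work under `Spine/NE7b/` by the row OWNER (`t4-ne7b-p1` gen 125, file (246)) under FREEZE
(0)'s crux-prover clause; NOTHING of Bałaban's is named as a Lean object, valued or asserted; no `T4Continuum/Support` leaf typed; no `def`,
no notation; zero `sorry`.  Imports (BY NAME): the OWNER's (225) `…SupZdPerturbedCovarianceLipschitz` (`zd_perturbed_covariance_lipschitz`),
(234) `…SupZdPerturbedCoarseForm` (`coarse_entry_le`, `sq_add_le`; through it (233) `decaying_inverse_form`, (231) `green_identity`, (191)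
`kernel_form_sq_le`, `zd_coarse_form_bounded`, (186) `zd_coarse_floor`, (222) `K_pos`, (191) `natAbs_sub_comm_sum`, (27) `mem_B`).

WHY (located).  The PACKAGING LESSON of gen 124: constants behind `∃` cannot be matched across headlines, so every property of the
column's objects must be available from ONE headline.  Gen 124 forked the chain ((225) vs (232)); gen 125 extended the (232) branch ((234)).
This file closes the fork: it calls (225) once and re-derives (F) and (G) for ITS objects — (F) by (231)'s Green identity and (C)'s
uniqueness exactly as (232), (G) by (186)'s floor + (191)'s Schur test on `T_K − T` and (233) exactly as (234) — with the extra hypotheses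
(`K` symmetric; the fourth smallness) as antecedents of inner implications.

WHAT IS PROVED ([folklore]): **`zd_perturbed_one_stop`** (THE END: `∃` nine constants from `(d, a, λ, Λ)`: for ALL data as in (225):
`∃ Ψ Ψ^K M N` with (A)–(E) of (225) verbatim, (F) and (G) as displayed); §2 toy.

HONEST (what this is NOT).  Packaging — no new estimate beyond (225)∕(232)∕(234); the `V`-Lipschitz statements (235)∕(245) and the torus
limits (243)∕(244) are already stated for ANY objects with these displayed clauses and so apply to this quadruple by name; scalar skeleton
((A3), NC-NE7b-α UNRULED); nothing of the covariant propagators of [B4]–[B6]; nothing of Bałaban's asserted.  BY-NAME EFFECT ON THE WALL: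
NONE.  NE7b NOT PRINTED ∕ NOT PROVED; spine PROVED 0∕9; rung (B)+1 — the programme's measures remain FINITE-torus statements; NOT the
mass gap, NOT Clay.  HONEST DEPENDENCY: continuum YM on T⁴ ⇐ BetaPertH ∧ nine spine estimates (0∕9 proved); BetaPertH ⇐ (D1) ∧ (D4) ∧
CAP+tail; G-an2-4 gates asym, D1 and NE2∕3∕4.
-/

set_option autoImplicit false

noncomputable section

namespace Summit.QuantumFields.BalabanUV.T4Continuum.NE7b.SupZdPerturbedOneStop

open Real Filter Topology
open scoped ENNReal
open Literature.MathematicalPhysics.QuantumFieldTheory.Balaban1983to89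
open B6QGQLower276 (X e blk B mem_B sum_B_const)
open SupZdCoarseForm (natAbs_sub_comm_sum kernel_form_sq_le zd_coarse_form_bounded)
open SupZdCoarseOperator (zd_coarse_floor)
open SupZdPerturbedColumn (K_pos)
open SupZdGreenIdentity (green_identity)
open SupZdKernelForm (decaying_inverse_form)
open SupZdPerturbedCoarseForm (coarse_entry_le sq_add_le)
open SupZdPerturbedCovarianceLipschitz (zd_perturbed_covariance_lipschitz)

variable {d : ℕ}

/-! ## §1. THE END: one headline for the `H + K` column on `ℤ^d` -/

/-- **HEADLINE — THE ONE-STOP STATEMENT OF THE `H + K` COLUMN ON `ℤ^d`**: `d ≥ 3`, `a > 0`, `λ < min(2,a)`, `Λ ≥ 0` ⟹ nine constants from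
`(d, a, λ, Λ)` such that for ALL data as in (225) there are `Ψ, Ψ^K, M, N` with (A)–(E) of (225), (F) `K` symmetric ⟹ `T_K`, `N_K` symmetric,
(G) `|T_K| ≤ 2C_PK_{δ₀−μ}e^{−μ|b−c|₁}` and, under `D_EK_μ ≤ γ_Q∕2`, the floor, the form bound and `N_K`'s `ℓ²` bounds. [folklore] -/
theorem zd_perturbed_one_stop (hd : 3 ≤ d) (a : ℝ) (ha : 0 < a) {lam Lam : ℝ} (hlam : lam < min 2 a) (hLam : 0 ≤ Lam) :
    ∃ C₀ CP δ₀ c₁ δ₁ C₀' CP' δ₀' ΛT : ℝ, 0 < C₀ ∧ 0 < CP ∧ 0 < δ₀ ∧ 0 < c₁ ∧ 0 < δ₁ ∧ 0 < C₀' ∧ 0 < CP' ∧ 0 < δ₀' ∧ 0 < ΛT ∧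
    ∀ (n : ℕ) (V : X d → ℝ), (∀ p, -lam ≤ V p) → (∀ p, V p ≤ Lam) →
    ∀ (ε γ μ ν : ℝ), 0 ≤ ε → 0 < μ → μ < δ₀ → μ < γ → 0 < ν → ν < μ → ν < δ₁ →
      ε * (2 * (1 - exp (-γ))⁻¹) ^ d * C₀ ≤ 1 / 2 →
      (CP * (2 * (1 - exp (-(δ₀ - μ)))⁻¹) ^ d) * (ε * exp (μ * d) * (2 * (1 - exp (-(γ - μ)))⁻¹) ^ d) ≤ 1 / 2 →
      (c₁ * exp (ν * d) * (2 * (1 - exp (-(δ₁ - ν)))⁻¹) ^ d)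
        * ((4 * (CP * (2 * (1 - exp (-(δ₀ - μ)))⁻¹) ^ d)
            * ((CP * (2 * (1 - exp (-(δ₀ - μ)))⁻¹) ^ d) * (ε * exp (μ * d) * (2 * (1 - exp (-(γ - μ)))⁻¹) ^ d)))
          * exp (ν * d) * (2 * (1 - exp (-(μ - ν)))⁻¹) ^ d) ≤ 1 / 2 →
      -- the Green's function's constants ((224)): range and two smallness conditions
      μ < δ₀' → ε * (2 * (1 - exp (-γ))⁻¹) ^ d * C₀' ≤ 1 / 2 →
      (CP' * (2 * (1 - exp (-(δ₀' - μ)))⁻¹) ^ d) * (ε * exp (μ * d) * (2 * (1 - exp (-(γ - μ)))⁻¹) ^ d) ≤ 1 / 2 →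
    ∀ (K : X d → X d → ℝ), (∀ p q, |K p q| ≤ ε * exp (-(γ * ∑ i, (((p i - q i).natAbs : ℕ) : ℝ)))) →
    ∃ Ψ ΨK M N : X d → X d → ℝ,
      -- (A) the block columns
      (∀ c p, ((n : ℝ) + 1) ^ 2 * ∑ μ', (2 * Ψ c p - Ψ c (p + e μ') - Ψ c (p - e μ'))
        + a / ((n : ℝ) + 1) ^ d * ∑ q ∈ B n (blk n p), Ψ c q + V p * Ψ c p = if blk n p = c then 1 else 0) ∧
      (∀ c p, |Ψ c p| ≤ 2 * (CP * (2 * (1 - exp (-(δ₀ - μ)))⁻¹) ^ d) * exp (-(μ * ∑ i, (((blk n p i - c i).natAbs : ℕ) : ℝ)))) ∧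
      (∀ c p, ((n : ℝ) + 1) ^ 2 * ∑ μ', (2 * ΨK c p - ΨK c (p + e μ') - ΨK c (p - e μ'))
        + a / ((n : ℝ) + 1) ^ d * ∑ q ∈ B n (blk n p), ΨK c q + V p * ΨK c p + ∑' q : X d, K p q * ΨK c q
          = if blk n p = c then 1 else 0) ∧
      (∀ c p, |ΨK c p| ≤ 2 * (CP * (2 * (1 - exp (-(δ₀ - μ)))⁻¹) ^ d) * exp (-(μ * ∑ i, (((blk n p i - c i).natAbs : ℕ) : ℝ)))) ∧
      (∀ c p, |ΨK c p - Ψ c p| ≤ 4 * (CP * (2 * (1 - exp (-(δ₀ - μ)))⁻¹) ^ d)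
        * ((CP * (2 * (1 - exp (-(δ₀ - μ)))⁻¹) ^ d) * (ε * exp (μ * d) * (2 * (1 - exp (-(γ - μ)))⁻¹) ^ d))
        * exp (-(μ * ∑ i, (((blk n p i - c i).natAbs : ℕ) : ℝ)))) ∧
      (∀ b c, |(((n : ℝ) + 1) ^ d)⁻¹ * ∑ q ∈ B n b, ΨK c q - (((n : ℝ) + 1) ^ d)⁻¹ * ∑ q ∈ B n b, Ψ c q|
        ≤ 4 * (CP * (2 * (1 - exp (-(δ₀ - μ)))⁻¹) ^ d)
          * ((CP * (2 * (1 - exp (-(δ₀ - μ)))⁻¹) ^ d) * (ε * exp (μ * d) * (2 * (1 - exp (-(γ - μ)))⁻¹) ^ d))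
          * exp (-(μ * ∑ i, (((b i - c i).natAbs : ℕ) : ℝ)))) ∧
      -- (B) the inverse of the coarse operator
      (∀ b b' : X d, Tendsto (fun R : ℕ =>
        if h : b ∈ (Fintype.piFinset fun _ : Fin d => Finset.Icc (-(R : ℤ)) R) ∧
            b' ∈ (Fintype.piFinset fun _ : Fin d => Finset.Icc (-(R : ℤ)) R)
          then (Matrix.of fun c c' : ↥(Fintype.piFinset fun _ : Fin d => Finset.Icc (-(R : ℤ)) R) =>
            (((n : ℝ) + 1) ^ d)⁻¹ * ∑ q ∈ B n (c : X d), Ψ (c' : X d) q)⁻¹ ⟨b, h.1⟩ ⟨b', h.2⟩ else 0)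
        atTop (𝓝 (M b b'))) ∧
      (∀ b c, |M b c| ≤ c₁ * exp (-(δ₁ * ∑ i, (((b i - c i).natAbs : ℕ) : ℝ)))) ∧
      (∀ b c, M b c = M c b) ∧
      (∀ b c, ∑' b' : X d, ((((n : ℝ) + 1) ^ d)⁻¹ * ∑ q ∈ B n b, Ψ b' q) * M b' c = if b = c then 1 else 0) ∧
      (∀ b c, ∑' b' : X d, M b b' * ((((n : ℝ) + 1) ^ d)⁻¹ * ∑ q ∈ B n b', Ψ c q) = if b = c then 1 else 0) ∧
      -- (C) the inverse of the perturbed coarse operator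
      (∀ b c, |N b c| ≤ 2 * (c₁ * exp (ν * d) * (2 * (1 - exp (-(δ₁ - ν)))⁻¹) ^ d) * exp (-(ν * ∑ i, (((b i - c i).natAbs : ℕ) : ℝ)))) ∧
      (∀ b c, Summable (fun b' : X d => ((((n : ℝ) + 1) ^ d)⁻¹ * ∑ q ∈ B n b, ΨK b' q) * N b' c) ∧
        ∑' b' : X d, ((((n : ℝ) + 1) ^ d)⁻¹ * ∑ q ∈ B n b, ΨK b' q) * N b' c = if b = c then 1 else 0) ∧
      (∀ b c, Summable (fun b' : X d => N b b' * ((((n : ℝ) + 1) ^ d)⁻¹ * ∑ q ∈ B n b', ΨK c q)) ∧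
        ∑' b' : X d, N b b' * ((((n : ℝ) + 1) ^ d)⁻¹ * ∑ q ∈ B n b', ΨK c q) = if b = c then 1 else 0) ∧
      (∀ b c, |N b c - M b c| ≤ 2 * (c₁ * exp (ν * d) * (2 * (1 - exp (-(δ₁ - ν)))⁻¹) ^ d)
        * ((c₁ * exp (ν * d) * (2 * (1 - exp (-(δ₁ - ν)))⁻¹) ^ d)
          * ((4 * (CP * (2 * (1 - exp (-(δ₀ - μ)))⁻¹) ^ d)
              * ((CP * (2 * (1 - exp (-(δ₀ - μ)))⁻¹) ^ d) * (ε * exp (μ * d) * (2 * (1 - exp (-(γ - μ)))⁻¹) ^ d)))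
            * exp (ν * d) * (2 * (1 - exp (-(μ - ν)))⁻¹) ^ d))
        * exp (-(ν * ∑ i, (((b i - c i).natAbs : ℕ) : ℝ)))) ∧
      (∀ (N' : X d → X d → ℝ) (C' ν' : ℝ), 0 ≤ C' → 0 < ν' →
        (∀ b c, |N' b c| ≤ C' * exp (-(ν' * ∑ i, (((b i - c i).natAbs : ℕ) : ℝ)))) →
        ((∀ b c, ∑' b' : X d, ((((n : ℝ) + 1) ^ d)⁻¹ * ∑ q ∈ B n b, ΨK b' q) * N' b' c = if b = c then 1 else 0) →
          ∀ b c, N' b c = N b c) ∧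
        ((∀ b c, ∑' b' : X d, N' b b' * ((((n : ℝ) + 1) ^ d)⁻¹ * ∑ q ∈ B n b', ΨK c q) = if b = c then 1 else 0) →
          ∀ b c, N' b c = N b c)) ∧
      -- (D) the response kernels are Lipschitz in `K`
      (∀ (b₀ p : X d),
        Summable (fun b' : X d => M b' b₀ * Ψ b' p) ∧ Summable (fun b' : X d => N b' b₀ * ΨK b' p) ∧
        |∑' b' : X d, N b' b₀ * ΨK b' p - ∑' b' : X d, M b' b₀ * Ψ b' p|
          ≤ (2 * (c₁ * exp (ν * d) * (2 * (1 - exp (-(δ₁ - ν)))⁻¹) ^ d)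
                * ((c₁ * exp (ν * d) * (2 * (1 - exp (-(δ₁ - ν)))⁻¹) ^ d)
                  * ((4 * (CP * (2 * (1 - exp (-(δ₀ - μ)))⁻¹) ^ d)
                      * ((CP * (2 * (1 - exp (-(δ₀ - μ)))⁻¹) ^ d) * (ε * exp (μ * d) * (2 * (1 - exp (-(γ - μ)))⁻¹) ^ d)))
                    * exp (ν * d) * (2 * (1 - exp (-(μ - ν)))⁻¹) ^ d))
                * (2 * (CP * (2 * (1 - exp (-(δ₀ - μ)))⁻¹) ^ d))
              + c₁ * (4 * (CP * (2 * (1 - exp (-(δ₀ - μ)))⁻¹) ^ d)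
                * ((CP * (2 * (1 - exp (-(δ₀ - μ)))⁻¹) ^ d) * (ε * exp (μ * d) * (2 * (1 - exp (-(γ - μ)))⁻¹) ^ d))))
            * (2 * (1 - exp (-(μ - ν)))⁻¹) ^ d * exp (-(ν * ∑ i, (((blk n p i - b₀ i).natAbs : ℕ) : ℝ)))) ∧
      -- (E) the fluctuation covariance is Lipschitz in `K`: `|C_Kf − Cf| = O(ε)` on profile sources, with decay
      (∀ (b₀ : X d) (Mf : ℝ) (f : X d → ℝ), (∀ p, |f p| ≤ Mf * exp (-(μ * ∑ i, (((blk n p i - b₀ i).natAbs : ℕ) : ℝ)))) →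
        ∀ (u : X d → ℝ) (Bu : ℝ), (∀ p, |u p| ≤ Bu) →
        (∀ p, ((n : ℝ) + 1) ^ 2 * ∑ μ', (2 * u p - u (p + e μ') - u (p - e μ'))
          + a / ((n : ℝ) + 1) ^ d * ∑ q ∈ B n (blk n p), u q + V p * u p = f p) →
        ∀ (uK : X d → ℝ) (BuK : ℝ), (∀ p, |uK p| ≤ BuK) →
        (∀ p, ((n : ℝ) + 1) ^ 2 * ∑ μ', (2 * uK p - uK (p + e μ') - uK (p - e μ'))
          + a / ((n : ℝ) + 1) ^ d * ∑ q ∈ B n (blk n p), uK q + V p * uK p + ∑' q : X d, K p q * uK q = f p) →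
        ∀ p, (Summable fun b'' : X d =>
            ((((n : ℝ) + 1) ^ d)⁻¹ * ∑ q ∈ B n b'', uK q) * ∑' b' : X d, N b' b'' * ΨK b' p) ∧
          (Summable fun b'' : X d =>
            ((((n : ℝ) + 1) ^ d)⁻¹ * ∑ q ∈ B n b'', u q) * ∑' b' : X d, M b' b'' * Ψ b' p) ∧
          |(uK p - ∑' b'' : X d, ((((n : ℝ) + 1) ^ d)⁻¹ * ∑ q ∈ B n b'', uK q) * ∑' b' : X d, N b' b'' * ΨK b' p)
            - (u p - ∑' b'' : X d, ((((n : ℝ) + 1) ^ d)⁻¹ * ∑ q ∈ B n b'', u q) * ∑' b' : X d, M b' b'' * Ψ b' p)|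
          ≤ (4 * (CP' * (2 * (1 - exp (-(δ₀' - μ)))⁻¹) ^ d)
                * ((CP' * (2 * (1 - exp (-(δ₀' - μ)))⁻¹) ^ d) * (ε * exp (μ * d) * (2 * (1 - exp (-(γ - μ)))⁻¹) ^ d))
              + ((4 * (CP' * (2 * (1 - exp (-(δ₀' - μ)))⁻¹) ^ d)
                  * ((CP' * (2 * (1 - exp (-(δ₀' - μ)))⁻¹) ^ d) * (ε * exp (μ * d) * (2 * (1 - exp (-(γ - μ)))⁻¹) ^ d)))
                  * ((2 * (c₁ * exp (ν * d) * (2 * (1 - exp (-(δ₁ - ν)))⁻¹) ^ d))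
                    * (2 * (CP * (2 * (1 - exp (-(δ₀ - μ)))⁻¹) ^ d)) * (2 * (1 - exp (-(μ - ν)))⁻¹) ^ d)
                + (2 * (CP' * (2 * (1 - exp (-(δ₀' - μ)))⁻¹) ^ d))
                  * ((2 * (c₁ * exp (ν * d) * (2 * (1 - exp (-(δ₁ - ν)))⁻¹) ^ d)
                      * ((c₁ * exp (ν * d) * (2 * (1 - exp (-(δ₁ - ν)))⁻¹) ^ d)
                        * ((4 * (CP * (2 * (1 - exp (-(δ₀ - μ)))⁻¹) ^ d)
                            * ((CP * (2 * (1 - exp (-(δ₀ - μ)))⁻¹) ^ d) * (ε * exp (μ * d) * (2 * (1 - exp (-(γ - μ)))⁻¹) ^ d)))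
                          * exp (ν * d) * (2 * (1 - exp (-(μ - ν)))⁻¹) ^ d))
                      * (2 * (CP * (2 * (1 - exp (-(δ₀ - μ)))⁻¹) ^ d))
                    + c₁ * (4 * (CP * (2 * (1 - exp (-(δ₀ - μ)))⁻¹) ^ d)
                      * ((CP * (2 * (1 - exp (-(δ₀ - μ)))⁻¹) ^ d) * (ε * exp (μ * d) * (2 * (1 - exp (-(γ - μ)))⁻¹) ^ d))))
                    * (2 * (1 - exp (-(μ - ν)))⁻¹) ^ d))
                * (2 * (1 - exp (-(μ - ν)))⁻¹) ^ d)
            * Mf * exp (-(ν * ∑ i, (((blk n p i - b₀ i).natAbs : ℕ) : ℝ)))) ∧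
      -- (F) SYMMETRY for a symmetric `K` ((231)'s Green identity, (C)'s uniqueness)
      ((∀ p q, K p q = K q p) →
        (∀ b c, (((n : ℝ) + 1) ^ d)⁻¹ * ∑ q ∈ B n b, ΨK c q = (((n : ℝ) + 1) ^ d)⁻¹ * ∑ q ∈ B n c, ΨK b q) ∧
        (∀ b c, N b c = N c b)) ∧
      -- (G) THE `ℓ²` COLUMN: entry decay always; floor, form bound and the form of `N_K` under `D_EK_μ ≤ γ_Q∕2`
      (∀ b c, |(((n : ℝ) + 1) ^ d)⁻¹ * ∑ q ∈ B n b, ΨK c q|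
        ≤ 2 * (CP * (2 * (1 - exp (-(δ₀ - μ)))⁻¹) ^ d) * exp (-(μ * ∑ i, (((b i - c i).natAbs : ℕ) : ℝ)))) ∧
      ((4 * (CP * (2 * (1 - exp (-(δ₀ - μ)))⁻¹) ^ d) * ((CP * (2 * (1 - exp (-(δ₀ - μ)))⁻¹) ^ d) * (ε * exp (μ * d) * (2 * (1 - exp (-(γ - μ)))⁻¹) ^ d)))
          * (2 * (1 - exp (-μ))⁻¹) ^ d ≤ 1 / ((36 : ℝ) ^ d * (4 * d + a + Lam)) / 2 →
        (∀ (S : Finset (X d)) (g : X d → ℝ), (∀ b, b ∉ S → g b = 0) →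
          1 / ((36 : ℝ) ^ d * (4 * d + a + Lam)) / 2 * ∑ b ∈ S, g b ^ 2
            ≤ ∑ b ∈ S, g b * ∑ c ∈ S, ((((n : ℝ) + 1) ^ d)⁻¹ * ∑ q ∈ B n b, ΨK c q) * g c) ∧
        (∀ (S : Finset (X d)) (g h : X d → ℝ),
          (∑ b ∈ S, h b * ∑ c ∈ S, ((((n : ℝ) + 1) ^ d)⁻¹ * ∑ q ∈ B n b, ΨK c q) * g c) ^ 2
            ≤ (ΛT + 1 / ((36 : ℝ) ^ d * (4 * d + a + Lam)) / 2) ^ 2 * (∑ b ∈ S, h b ^ 2) * ∑ c ∈ S, g c ^ 2) ∧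
        (∀ (S : Finset (X d)) (k : X d → ℝ), (∀ b, b ∉ S → k b = 0) →
          (∀ b, ∑' c : X d, ((((n : ℝ) + 1) ^ d)⁻¹ * ∑ q ∈ B n b, ΨK c q) * ∑ c' ∈ S, N c c' * k c' = k b) ∧
          Summable (fun b => (∑ c ∈ S, N b c * k c) ^ 2) ∧
          (∀ F : Finset (X d), ∑ b ∈ F, (∑ c ∈ S, N b c * k c) ^ 2 ≤ ∑' b, (∑ c ∈ S, N b c * k c) ^ 2) ∧
          (∑' b, (∑ c ∈ S, N b c * k c) ^ 2 ≤ (1 / (1 / ((36 : ℝ) ^ d * (4 * d + a + Lam)) / 2)) ^ 2 * ∑ b ∈ S, k b ^ 2) ∧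
          (1 / ((36 : ℝ) ^ d * (4 * d + a + Lam)) / 2 * ∑' b, (∑ c ∈ S, N b c * k c) ^ 2 ≤ ∑ b ∈ S, k b * ∑ c ∈ S, N b c * k c) ∧
          (∑ b ∈ S, k b * ∑ c ∈ S, N b c * k c ≤ 1 / (1 / ((36 : ℝ) ^ d * (4 * d + a + Lam)) / 2) * ∑ b ∈ S, k b ^ 2) ∧
          (1 / ((36 : ℝ) ^ d * (4 * d + a + Lam)) / 2 / (ΛT + 1 / ((36 : ℝ) ^ d * (4 * d + a + Lam)) / 2) ^ 2 * ∑ b ∈ S, k b ^ 2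
            ≤ ∑ b ∈ S, k b * ∑ c ∈ S, N b c * k c))) := by
  classical
  obtain ⟨C₀, CP, δ₀, c₁, δ₁, C₀', CP', δ₀', hC₀, hCP, hδ₀, hc₁, hδ₁, hC₀', hCP', hδ₀', H225⟩ :=
    zd_perturbed_covariance_lipschitz (d := d) hd a ha hlam hLam
  obtain ⟨ΛT, hΛT, H191⟩ := zd_coarse_form_bounded (d := d) hd a ha hlam hLam
  refine ⟨C₀, CP, δ₀, c₁, δ₁, C₀', CP', δ₀', ΛT, hC₀, hCP, hδ₀, hc₁, hδ₁, hC₀', hCP', hδ₀', hΛT, ?_⟩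
  intro n V hV hV' ε γ μ ν hε hμ hμδ hμγ hν hνμ hνδ hsmall1 hsmall2 hsmall3 hμδe hsmall1e hsmall2e K hK
  obtain ⟨Ψ, ΨK, M, N, hA1, hA2, hA3, hA4, hA5, hA6, hB1, hB2, hB3, hB4, hB5, hC1, hC2, hC3, hC4, hC5, hD, hE⟩ :=
    H225 n V hV hV' ε γ μ ν hε hμ hμδ hμγ hν hνμ hνδ hsmall1 hsmall2 hsmall3 hμδe hsmall1e hsmall2e K hK
  refine ⟨Ψ, ΨK, M, N, hA1, hA2, hA3, hA4, hA5, hA6, hB1, hB2, hB3, hB4, hB5, hC1, hC2, hC3, hC4, hC5, hD, hE, fun hKs => ?_, ?_, ?_⟩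
  · -- (F): (232)'s argument
    have hγ : 0 < γ := hμ.trans hμγ
    have hVb : ∀ p, |V p| ≤ |lam| + |Lam| := fun p =>
      abs_le.2 ⟨by linarith [hV p, le_abs_self lam, abs_nonneg Lam], by linarith [hV' p, le_abs_self Lam, abs_nonneg lam]⟩
    have hind : ∀ (c : X d) (u : X d → ℝ), ∑' p : X d, u p * (if blk n p = c then (1 : ℝ) else 0) = ∑ p ∈ B n c, u p := by
      intro c u
      have h : ∀ p ∉ B n c, u p * (if blk n p = c then (1 : ℝ) else 0) = 0 := fun p hp => by
        rw [if_neg (fun h' => hp (mem_B.2 h')), mul_zero]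
      rw [(hasSum_sum_of_ne_finset_zero h).tsum_eq]
      exact Finset.sum_congr rfl fun p hp => by rw [if_pos (mem_B.1 hp), mul_one]
    have hTsym : ∀ b c, (((n : ℝ) + 1) ^ d)⁻¹ * ∑ q ∈ B n b, ΨK c q = (((n : ℝ) + 1) ^ d)⁻¹ * ∑ q ∈ B n c, ΨK b q := by
      intro b c
      obtain ⟨-, hG⟩ := green_identity (d := d) n a hμ hε hγ b c (ΨK b) (ΨK c) (hA4 b) (hA4 c) V hVb K hK hKs
      simp only [hA3] at hG
      rw [hind c (ΨK b), hind b (ΨK c)] at hG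
      rw [hG]
    refine ⟨hTsym, fun b c => ?_⟩
    have hK1 : 0 < (2 * (1 - exp (-(δ₁ - ν)))⁻¹) ^ d := K_pos (d := d) (sub_pos.2 hνδ)
    have hCN : 0 ≤ 2 * (c₁ * exp (ν * d) * (2 * (1 - exp (-(δ₁ - ν)))⁻¹) ^ d) := by positivity
    have hNt : ∀ b c, |N c b| ≤ 2 * (c₁ * exp (ν * d) * (2 * (1 - exp (-(δ₁ - ν)))⁻¹) ^ d)
        * exp (-(ν * ∑ i, (((b i - c i).natAbs : ℕ) : ℝ))) := fun b c => by rw [natAbs_sub_comm_sum]; exact hC1 c b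
    have hleft : ∀ b c, ∑' b' : X d, N b' b * ((((n : ℝ) + 1) ^ d)⁻¹ * ∑ q ∈ B n b', ΨK c q) = if b = c then 1 else 0 := by
      intro b c
      have h := (hC2 c b).2
      have e : (fun b' : X d => N b' b * ((((n : ℝ) + 1) ^ d)⁻¹ * ∑ q ∈ B n b', ΨK c q))
          = fun b' => ((((n : ℝ) + 1) ^ d)⁻¹ * ∑ q ∈ B n c, ΨK b' q) * N b' b := funext fun b' => by rw [hTsym b' c, mul_comm]
      rw [e, h]
      by_cases hbc : b = c
      · rw [if_pos hbc, if_pos hbc.symm]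
      · rw [if_neg hbc, if_neg (fun h' => hbc h'.symm)]
    exact ((hC5 (fun b c => N c b) _ ν hCN hν hNt).2 hleft b c).symm
  · -- (G), entry decay: block means inherit the profile
    exact fun b c => coarse_entry_le n ΨK c (hA4 c) b
  · -- (G), under the fourth smallness: (234)'s argument
    intro hsmall4
    have hγQ : (0 : ℝ) < 1 / ((36 : ℝ) ^ d * (4 * d + a + Lam)) := by positivity
    have hK0 : 0 < (2 * (1 - exp (-(δ₀ - μ)))⁻¹) ^ d := K_pos (d := d) (sub_pos.2 hμδ)
    have hKμ : 0 < (2 * (1 - exp (-μ))⁻¹) ^ d := K_pos (d := d) hμ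
    have hK1 : 0 < (2 * (1 - exp (-(γ - μ)))⁻¹) ^ d := K_pos (d := d) (sub_pos.2 hμγ)
    have hK2 : 0 < (2 * (1 - exp (-(δ₁ - ν)))⁻¹) ^ d := K_pos (d := d) (sub_pos.2 hνδ)
    obtain ⟨DE, hDE⟩ : ∃ DE : ℝ, DE = 4 * (CP * (2 * (1 - exp (-(δ₀ - μ)))⁻¹) ^ d) * ((CP * (2 * (1 - exp (-(δ₀ - μ)))⁻¹) ^ d) * (ε * exp (μ * d) * (2 * (1 - exp (-(γ - μ)))⁻¹) ^ d)) := ⟨_, rfl⟩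
    have hDE0 : 0 ≤ DE := by rw [hDE]; positivity
    rw [← hDE] at hsmall4
    obtain ⟨T, hT⟩ : ∃ T : X d → X d → ℝ, ∀ b c, T b c = (((n : ℝ) + 1) ^ d)⁻¹ * ∑ q ∈ B n b, Ψ c q := ⟨_, fun _ _ => rfl⟩
    obtain ⟨TK, hTK⟩ : ∃ TK : X d → X d → ℝ, ∀ b c, TK b c = (((n : ℝ) + 1) ^ d)⁻¹ * ∑ q ∈ B n b, ΨK c q := ⟨_, fun _ _ => rfl⟩
    have hΨb : ∀ c p, |Ψ c p| ≤ 2 * (CP * (2 * (1 - exp (-(δ₀ - μ)))⁻¹) ^ d) := fun c p =>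
      (hA2 c p).trans (mul_le_of_le_one_right (by positivity) (exp_le_one_iff.2 (by rw [neg_nonpos]; positivity)))
    have hTKd : ∀ b c, |TK b c| ≤ 2 * (CP * (2 * (1 - exp (-(δ₀ - μ)))⁻¹) ^ d) * exp (-(μ * ∑ i, (((b i - c i).natAbs : ℕ) : ℝ))) :=
      fun b c => by rw [hTK]; exact coarse_entry_le n ΨK c (hA4 c) b
    have hEd : ∀ b c, |TK b c - T b c| ≤ DE * exp (-(μ * ∑ i, (((b i - c i).natAbs : ℕ) : ℝ))) := fun b c => by
      rw [hTK, hT, hDE]; exact hA6 b c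
    have hsplit : ∀ (S : Finset (X d)) (g h : X d → ℝ), ∑ b ∈ S, h b * ∑ c ∈ S, TK b c * g c
        = ∑ b ∈ S, h b * ∑ c ∈ S, T b c * g c + ∑ b ∈ S, h b * ∑ c ∈ S, (TK b c - T b c) * g c := fun S g h => by
      rw [← Finset.sum_add_distrib]
      refine Finset.sum_congr rfl fun b _ => ?_
      rw [← mul_add, ← Finset.sum_add_distrib]
      exact congrArg _ (Finset.sum_congr rfl fun c _ => by ring)
    have hE1 : ∀ (S : Finset (X d)) (g : X d → ℝ), (∀ b, b ∉ S → g b = 0) →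
        1 / ((36 : ℝ) ^ d * (4 * d + a + Lam)) / 2 * ∑ b ∈ S, g b ^ 2 ≤ ∑ b ∈ S, g b * ∑ c ∈ S, TK b c * g c := by
      intro S g hg
      have h186 := zd_coarse_floor hd a ha hlam hLam n V hV hV' Ψ (fun _ => 2 * (CP * (2 * (1 - exp (-(δ₀ - μ)))⁻¹) ^ d)) hΨb hA1 S g hg
      simp only [← hT] at h186
      have hS0 : 0 ≤ ∑ b ∈ S, g b ^ 2 := Finset.sum_nonneg fun _ _ => sq_nonneg _
      have hEf := kernel_form_sq_le hμ (fun b c => TK b c - T b c) hEd S g g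
      have hEabs : |∑ b ∈ S, g b * ∑ c ∈ S, (TK b c - T b c) * g c| ≤ DE * (2 * (1 - exp (-μ))⁻¹) ^ d * ∑ b ∈ S, g b ^ 2 :=
        abs_le_of_sq_le_sq (hEf.trans (le_of_eq (by ring))) (by positivity)
      have hEle : DE * (2 * (1 - exp (-μ))⁻¹) ^ d * ∑ b ∈ S, g b ^ 2 ≤ 1 / ((36 : ℝ) ^ d * (4 * d + a + Lam)) / 2 * ∑ b ∈ S, g b ^ 2 :=
        mul_le_mul_of_nonneg_right hsmall4 hS0
      rw [hsplit S g g]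
      linarith [neg_abs_le (∑ b ∈ S, g b * ∑ c ∈ S, (TK b c - T b c) * g c)]
    have hE2 : ∀ (S : Finset (X d)) (g h : X d → ℝ),
        (∑ b ∈ S, h b * ∑ c ∈ S, TK b c * g c) ^ 2 ≤ (ΛT + 1 / ((36 : ℝ) ^ d * (4 * d + a + Lam)) / 2) ^ 2 * (∑ b ∈ S, h b ^ 2) * ∑ c ∈ S, g c ^ 2 := by
      intro S g h
      have h191 := (H191 n V hV hV' Ψ (fun _ => 2 * (CP * (2 * (1 - exp (-(δ₀ - μ)))⁻¹) ^ d)) hΨb hA1 S g h).1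
      simp only [← hT] at h191
      have hEf := kernel_form_sq_le hμ (fun b c => TK b c - T b c) hEd S g h
      have hc : 0 ≤ (∑ b ∈ S, h b ^ 2) * ∑ c ∈ S, g c ^ 2 :=
        mul_nonneg (Finset.sum_nonneg fun _ _ => sq_nonneg _) (Finset.sum_nonneg fun _ _ => sq_nonneg _)
      have h1 := sq_add_le hΛT.le (by positivity : 0 ≤ DE * (2 * (1 - exp (-μ))⁻¹) ^ d) hc
        (by rw [← mul_assoc]; exact h191) (by rw [← mul_assoc]; exact hEf)
      rw [hsplit S g h, mul_assoc]
      refine h1.trans (mul_le_mul_of_nonneg_right (pow_le_pow_left₀ (by positivity) (by linarith) 2) hc)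
    have hC2' : ∀ b c, ∑' b' : X d, TK b b' * N b' c = if b = c then 1 else 0 := fun b c => by
      simp only [hTK]; exact (hC2 b c).2
    have hE3 := fun (S : Finset (X d)) (k : X d → ℝ) (hk : ∀ b, b ∉ S → k b = 0) =>
      decaying_inverse_form (d := d) hμ (half_pos hγQ) (by positivity : 0 < ΛT + 1 / ((36 : ℝ) ^ d * (4 * d + a + Lam)) / 2)
        (by positivity : (0 : ℝ) ≤ 2 * (c₁ * exp (ν * d) * (2 * (1 - exp (-(δ₁ - ν)))⁻¹) ^ d)) hν TK N hTKd hE1 hE2 hC1 hC2' S k hk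
    simp only [hTK] at hE1 hE2 hE3
    exact ⟨hE1, hE2, hE3⟩

/-! ## §2. Toy -/

/-- Toy (`d = 3`, `a = 1`, `λ = 0`, `Λ = 1`): the nine constants exist. -/
example : ∃ C₀ CP δ₀ c₁ δ₁ C₀' CP' δ₀' ΛT : ℝ, 0 < C₀ ∧ 0 < CP ∧ 0 < δ₀ ∧ 0 < c₁ ∧ 0 < δ₁ ∧ 0 < C₀' ∧ 0 < CP' ∧ 0 < δ₀' ∧ 0 < ΛT :=
  let ⟨C₀, CP, δ₀, c₁, δ₁, C₀', CP', δ₀', ΛT, h1, h2, h3, h4, h5, h6, h7, h8, h9, _⟩ :=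
    zd_perturbed_one_stop (d := 3) le_rfl 1 one_pos (lam := 0) (Lam := 1)
      (by rw [min_eq_right (by norm_num : (1 : ℝ) ≤ 2)]; norm_num) zero_le_one
  ⟨C₀, CP, δ₀, c₁, δ₁, C₀', CP', δ₀', ΛT, h1, h2, h3, h4, h5, h6, h7, h8, h9⟩

end Summit.QuantumFields.BalabanUV.T4Continuum.NE7b.SupZdPerturbedOneStop
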